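import Mathlib.Algebra.Ring.Subring.Units
import Mathlib.Analysis.Complex.Basic
import Mathlib.GroupTheory.Coset.Defs
import Mathlib.LinearAlgebra.Matrix.GeneralLinearGroup.Defs
import Literature.NumberTheory.Automorphic.UnitaryGroupFinAdelicCenter
import Literature.NumberTheory.Automorphic.UnitarySimilitudeNormTorus
import Literature.AlgebraicGeometry.Motives.Varieties
import HarnessLib

/-!
# Kudla–Rapoport 2013, §4 «Relation to Shimura varieties» — the numbered statements (named facts; the four CLOSED ones proved, ED. 3)

[KudlaRapoport2013] = S. Kudla, M. Rapoport, *Special cycles on unitary Shimura varieties II: global theory*, J. reine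
angew. Math. **697** (2014) 91–157 = arXiv 0912.3758.  SOURCES READ: the held TeX `paper:arxiv-0912.3758` (chunks
p0014–p0016; this store text is arXiv **v1**, 18 Dec 2009) for the formulas, and the per-page text of arXiv **v2** (18 Dec
2012, «Accepted for publication in Crelle»; squad kit `T/KR/TKR-t02/g0/KR2013-arXivv2-pages.txt`, pp. 19–22) for numbering
and page pins: pins «(arXiv v2 p. N)» below are v2 PDF pages.  In §4 the numbered items (Remark 4.1, Remark 4.2,
Proposition 4.3, Proposition 4.4, Remark 4.5) and the displays (4.1)–(4.5) carry the SAME numbers in v1 and v2.  Two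
version deltas: (a) v1 closes §4 with a «Proposition 4.6» (numbers of geometrically irreducible components of
`𝓜(n−r,r) ×_{𝒪_k} k`; «We omit the proof») which is ABSENT from v2 — it is recorded in the census below and NOT typed (no
printed proof in any version); (b) in §4.2 (2) v1 has «`λ` is a principal polarization», v2 «`λ` is a polarization» — v2
is followed.  Companions (same directory, other seats of squad TKR): `Sec2GlobalModuliProblem` (the stack `𝓜(n−r,r)`,
(2.1), the genera decomposition), `Sec3ComplexUniformization` (`D(V)`, `h`, `𝓜(n−r,r)(ℂ)`); not imported.

## Setting (§4 preamble and §4.1, arXiv v2 p. 19)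

`k` an imaginary quadratic field with non-trivial automorphism `σ` (`a ↦ aσ`), `𝒪_k` its integers; «When `n > 1`, we
assume that `r(n−r) > 0`, and we fix an embedding `τ` of `k` into `ℂ`.»  «We fix a hermitian vector space `V` over `k`
of signature `(n−r, r)` and write `G = G^V = GU(V)`» (unitary similitudes, similitude factor `ν : G → 𝔾_m`).  «For an
open compact subgroup `K ⊂ G(𝔸_f)`, there is a Shimura variety `Sh^V_K` over `k`» (footnote 2: «In the case where `n` is
even and `r = n−r`, the reflex field is `ℚ`, and we take `Sh^V_K` to be the base change to `k` of the usual canonical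
model.») «with (4.1) `Sh^V_K(ℂ) ≃ G(ℚ)\(D × G(𝔸_f)/K)`.»

COORDINATES (READING, as in the tree's unitary-group files `NumberTheory/Automorphic/UnitaryGroup*` and
`LinearAlgebra/Matrix/HermitianSimilitudeDeterminant`): a basis of `V` is chosen, `J ∈ M_n(k)` is the Gram matrix,
`(x, y) = (xσ)ᵀ J y`; for a commutative ring `R` with a ring endomorphism `σ` (the cases used: `R = k`, `σ` = the
conjugation; `R = 𝔸_{k,f} = FiniteAdeleRing (𝓞 k) k`, `σ = c ⊗ 1` = the tree's `UnitaryGroup.conjFiniteAdele ℚ k c`;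
`R = k ⊗_ℚ R₀`, `σ = c ⊗ 1`) the `R`-points of `GU(V)` are the pairs `(g, ν) ∈ GL_n(R) × R^×` with `σ(ν) = ν` and
`(gσ)ᵀ J g = ν J` (the GRAPH of the multiplier: `ν` is then the second projection and no choice is involved), `U(V)(R)` is
the tree's `unitaryGroupOfForm σ J` and `SU(V)(R) = U(V)(R) ∩ ker det`.  Every printed notion typed below is basis-free.

## How each item of §4 is carried (COMPLETENESS CENSUS — v2 items 4.1–4.5, displays (4.1)–(4.5), v1-only 4.6)

Conventions: `def KR2013_4_… : Prop` CLOSED = a NAMED FACT (nothing asserted; true as written, hypotheses complete);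
`def KR2013_4_… (data) : Prop` = the printed statement as a PREDICATE on explicit data, where ⟨CARRIER⟩ marks a parameter
standing for an object Lean lacks (its meaning is the docstring); REAL = a definition with body over Mathlib/tree notions.

| item (arXiv v2 page) | disposition |
|---|---|
| §4 preamble + §4.1 (p. 19): `G = GU(V)`, `Sh^V_K` over `k`, footnote 2 (reflex field `ℚ` when `n` even, `r = n−r`) | `GU` (REAL).  The reflex-field sentences are ★ ALREADY IN THE TREE — CITED, not restated: `Literature.NumberTheory.ComplexMultiplication.adjoin_sum_eq_bot_iff_of_rsz` (`E_r = ℚ ⟺ 2r = n` for imaginary quadratic `k`), `…adjoin_sum_eq_fieldRange_of_kr_of_finrank_eq_two` ∕ `…adjoin_sum_eq_bot_of_kr_of_finrank_eq_two` (file `KudlaRapoportSignatureReflexField`). |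
| (4.1) `Sh^V_K(ℂ) ≃ G(ℚ)\(D × G(𝔸_f)/K)` (p. 19) | **not typed**: this is [Deligne1979] 2.1.2 (the definition of the complex Shimura variety); the tree's instance for `U(H)` is ★ `ShimuraVarieties.Deligne1979.complexPoints_eq_finite_disjoint_sum`; `D = D(V)` is §3 (companion `Sec3ComplexUniformization`). |
| Remark 4.1 (p. 19) strictly similar spaces (`( , )' = c( , )`, `c ∈ ℚ₊^×`) define the same Shimura varieties | `KR2013_4_1_rem_GU_smul_eq` (named fact: the group half, `GU(cJ) = GU(J)` for a unit `c`; PROVED, ED. 3: `KR2013_4_1_rem_GU_smul_eq_holds`); the domain half `D(cV) = D(V)` (`c > 0`) is §3. |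
| §4.2 (pp. 19–20): the groupoid `Sh^V_K` of up-to-isogeny tuples `(A, ι, λ, η̄)` — (1) abelian scheme up to isogeny with `k`-action, (2) polarization (footnote 3), (3) `K`-level structure, Rosati condition, (4.2) Kottwitz condition `det(T − ι(a) ∣ Lie A) = (T − φ(a))^{n−r}(T − φ(aσ))^r`, morphisms; Remark 4.2 (p. 20; (4.3) `Ẑ(1) = lim μ_n(k(s))`, (4.4) `Ẑ(1) ≅ Ẑ`, `π₁(S,s)`-stable `K`-orbits) | **not typed** (definition prose over abelian schemes up to isogeny, rational Tate modules as `𝔸_f`-sheaves and `π₁`-invariance — no carrier in Mathlib/the tree to state it on faithfully); (4.2) = (2.1) of §2 with `k` for `𝒪_k` (companion `Sec2GlobalModuliProblem`); the tree's instance of the Kottwitz/signature condition over `ℂ` is ★ `AlgebraicGeometry.ComplexMultiplication.EndomorphismFieldSignatureCondition` ∕ `…DeterminantCondition`. |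
| Proposition 4.3 (p. 20): `Sh^V_K` is a smooth Deligne–Mumford stack over `Spec k`; for `K` small a quasi-projective scheme naturally isomorphic to the canonical model `Sh^V_K`; `Sh^V_K(ℂ)` = the double coset space (4.1) (as an orbifold when `K` is not small) | **not typed** (DM stacks ∕ canonical models: no vocabulary; the `ℂ`-points clause is (4.1)). |
| Proposition 4.4 (p. 20): `𝓜(n−r,r)^{V♯} ×_{Spec 𝒪_k} Spec k ≃ Sh^V_{K♯}` (`K♯` = stabiliser in `G^V(𝔸_f)` of a self-dual lattice in the `G^V_1`-genus of `V♯`) | `KR2013_4_4_genericFibre` WEAKER-THAN-PRINT: the isomorphism of stacks over `k` recorded as a natural bijection between the ⟨CARRIER⟩ presheaves of isomorphism classes of `S`-points on `k`-schemes (tree ★ `Motives.SchemeOver k`). |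
| Remark 4.5 (p. 21): both sides depend only on the strict similitude class of `V`; for `n` odd there is one class | census only (the first clause is Remark 4.1 + §3; «one class for `n` odd» is §2, companion `Sec2GlobalModuliProblem`). |
| §4.4 (p. 21) «canonical model over the reflex field `E`, where `E = ℚ` if `r = n−r`, and `E = k` otherwise» | ★ CITED (as for footnote 2 above), not restated. |
| §4.4 (p. 21): the torus `T` (`T¹ × 𝔾_m` for `n` even, `Res_{k/ℚ} 𝔾_m` for `n` odd; `T¹ = ker N`), `ν° : G → T` | REAL: `nuCircOdd`, `nuCircEven` (the printed formulas on `GU`), `SU`; `T(𝔸_f)`, `T(ℚ)⁰ ⊂ T(𝔸_f)` REAL: `torusFinAdeleEven`, `torusRatZeroOdd`, `torusRatZeroEven` (with `T¹(𝔸_f)` = ★ `UnitaryGroup.finAdelicOne ℚ k c`). |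
| §4.4 (p. 21) «in the odd case `N(ν°(g)) = ν(g)`. In particular, `ker(ν°) = SU(V)` in both cases» (+ the implicit `ν°(g) ∈ T¹ × 𝔾_m` for `n` even) | `KR2013_4_4_norm_nuCirc`, `KR2013_4_4_ker_nuCirc` (named facts, PROVED in ED. 3: `KR2013_4_4_norm_nuCirc_holds`, `KR2013_4_4_ker_nuCirc_holds`, from ★ `NumberTheory.Automorphic.UnitarySimilitude.sigma_det_mul_det_eq_pow`; the underlying `N(det g) = ν(g)ⁿ` is ★ `LinearAlgebra.Matrix.HermitianSimilitudeDeterminant.star_det_mul_det_eq_pow`). |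
| (4.5) (p. 21) `π₀(Sh^V_K) ≃ T(ℚ)\T(𝔸)/ν°(K_∞ × K) = T(ℚ)⁰\T(𝔸_f)/ν°(K)` | `KR2013_4_5_pi0_odd`, `KR2013_4_5_pi0_even`: the second (finite-adelic) description as predicates on `(K, π₀)` with ⟨CARRIER⟩ `π₀ = π₀(Sh^V_K)`; «`ν°(K_∞) = T(ℝ)⁰`» (p. 22) enters through the REAL `T(ℚ)⁰` and is not typed separately (real points). |
| §4.4 (p. 22) «a simple calculation shows» `ν° ∘ h(z) = ((z/z̄)^{k−r}, z z̄)` (`n = 2k`), `(z/z̄)^{k−r} z` (`n = 2k+1`) | `KR2013_4_4_nuCirc_hodge` (named fact, PROVED in ED. 3: `KR2013_4_4_nuCirc_hodge_holds`; an identity in `ℂ` from `det h(z) = z^{n−r} z̄^r`, `ν(h(z)) = z z̄` — §3, p. 15: `h(z)` acts by `z` on the positive `(n−r)`-plane and by `z̄` on the negative `r`-plane, «`ν(h(z)) = |z|²`»). |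
| §4.4 (p. 22): `ρ = N_{E/ℚ} ∘ ν° ∘ μ_h : 𝕊_ℚ → T`, `ρ(a) = ((a/ā)^{k−r}, a ā)` (`n = 2k`, `r ≠ n−r`), `(1, a)` (`n = 2k`, `r = n−r`), `(a/ā)^{k−r} a` (`n = 2k+1`); footnote 4 (sign correction to [49] (1.15)) | REAL: `rhoEven`, `rhoEvenMiddle`, `rhoOdd` (the three printed formulas; that they equal `N_{E/ℚ} ∘ ν° ∘ μ_h` is the printed derivation, not typed). |
| §4.4 (p. 22): `σ ∈ Gal(ℚ̄/E)` acts on `π₀(Sh^V_K)`, on the right side of (4.5), by multiplication by `ρ(x_σ)`, `x_σ ∈ 𝔸_E^×` with Artin image `σ∣E^{ab}` (a local uniformizer ↦ the inverse of Frobenius) | **not typed** (class field theory normalisation and `π₀` of a canonical model: recorded verbatim; `ρ` is REAL so a consumer posits the action on its own datum — precedent: the tree's `Liu2021/AppendixC/DefC1toC3` Rem. C.2). |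
| v1-only «Proposition 4.6» (arXiv v1 p. 28; «We omit the proof»): `r(n−r) > 0`; (i) `n` odd: `𝓜(n−r,r)_k` is the disjoint union of `h_k` geometrically irreducible components, disjoint over `Spec 𝒪_k[(2Δ)⁻¹]`; (ii) `n` even: `𝓜(n−r,r)_k^{V♯}` has `2^{1−δ} h_k` components, except when `ord₂(Δ) = 2`, `L ⊗ ℤ₂ ≃ H(0)^{n/2}`, where it has `2^{2−δ} h_k` (`k ≠ ℚ(√−1)`) resp. `1` (`k = ℚ(√−1)`); with the explanation `ν°(K_L) = Ô_k^×` (`n` odd), `Ô_k¹ × Ẑ^×` resp. `Ô_k^{1*} × Ẑ^×` (`n` even) | **NOT TYPED and not citable as [KudlaRapoport2013]**: absent from the accepted text (v2 = Crelle), no proof in v1. |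

DEDUP (2026-09-02): `lean search` for `GU` ∕ unitary similitude ∕ `nuCirc` ∕ `π₀` of unitary Shimura varieties: the tree
has `unitaryGroupOfForm` (used), `finAdelicOne` (used), `HermitianSimilitudeDeterminant` (theorems on `Gᴴ H G = α H`, no
group; cited), `ModuliOfAbelianVarieties.SymplecticSimilitudeGroup.similitudeGroupOfForm` (the symplectic `ᵀ`-version, not
this), `UnitaryCanonicalModel.Aux.torusRat ∕ torusFinAdelic ∕ classGroup` (the torus `{z | z·c(z) ∈ ℚ^×}` of a DIFFERENT
datum — not `T`); nothing of §4 is in Mathlib; `rg 'cite: KudlaRapoport2013, §4'` = the reflex-field files above (★ cited).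
No instance, notation or axiom.  ED. 3 (R-9a, «a closed fact provable from the tree is a theorem»): the four CLOSED named
facts are DISCHARGED at the end of the file (`…_holds`, section «Discharges»; the defs stay so that users' `(h : X)` are fed
`X_holds`); these are identities of matrices ∕ units ∕ complex powers and assert nothing about Shimura varieties — no
printed statement of [KudlaRapoport2013] about `Sh^V_K` or `𝓜(n−r,r)` is asserted in this file.
-/

universe u

open Matrix CategoryTheory NumberField IsDedekindDomain
open scoped Matrix

namespace Literature.AlgebraicGeometry.ShimuraVarieties.KudlaRapoport2013.Sec4RelationToShimuraVarieties

open Literature.NumberTheory.Automorphic (unitaryGroupOfForm)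
open Literature.NumberTheory.Automorphic.UnitaryGroup (conjFiniteAdele finAdelicOne)
open Literature.AlgebraicGeometry.Motives (SchemeOver)

/-! ## §4.1 The unitary similitude group `G = GU(V)` (coordinates) and Remark 4.1 -/

section Similitudes

variable {R : Type*} [CommRing R] {m : Type*} [Fintype m] [DecidableEq m]

/-- **`GU(V)(R)`, the `R`-points of the unitary similitude group** of the hermitian form with Gram matrix `J` with respect to
the ring endomorphism `σ` (§4.1, p. 19: «write `G = G^V = GU(V)`»; §3, p. 15: «`h(z) h(z)* = ν(h(z))`»), typed as the GRAPH
OF THE MULTIPLIER: the set of pairs `(g, ν) ∈ GL_m(R) × R^×` with `σ(ν) = ν` (the similitude factor lies in the base,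
`ν : G → 𝔾_{m,ℚ}`) and `(gσ)ᵀ J g = ν J` (entrywise `σ`, as in the tree's `unitaryGroupOfForm σ J`, which is the fibre
`ν = 1`).  REAL; a `Set` (closure under the group law is a bookkeeping lemma left to a prover seat, not needed to state §4).
[cite: KudlaRapoport2013, §4.1 (arXiv v2 p. 19)] -/
def GU (σ : R →+* R) (J : Matrix m m R) : Set (GL m R × Rˣ) :=
  {p | σ (p.2 : R) = (p.2 : R) ∧
    ((p.1 : Matrix m m R).map σ)ᵀ * J * (p.1 : Matrix m m R) = (p.2 : R) • J}

/-- **`SU(V)(R) = {g ∈ U(V)(R) | det g = 1}`** (§4.4, p. 21: «`ker(ν°) = SU(V)`»), REAL as the subgroup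
`unitaryGroupOfForm σ J ⊓ ker det` of `GL_m(R)` (`U(V)` = the tree's `unitaryGroupOfForm`, `det` = Mathlib's
`Matrix.GeneralLinearGroup.det : GL_m(R) →* R^×`).
[cite: KudlaRapoport2013, §4.4 (arXiv v2 p. 21)] -/
def SU (σ : R →+* R) (J : Matrix m m R) : Subgroup (GL m R) :=
  unitaryGroupOfForm σ J ⊓ (Matrix.GeneralLinearGroup.det : GL m R →* Rˣ).ker

/-- **Remark 4.1 (the group-theoretic half).**  Printed (p. 19): «We note that two hermitian spaces `V, ( , )` and
`V', ( , )'` which are strictly similar, i.e., `V ≃ V'` with `( , )' = c ( , )` for `c ∈ ℚ₊^×`, define the same Shimura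
varieties.»  TYPED: scaling the Gram matrix by a unit `c` of `R` does not change the similitude group,
`GU(σ, cJ)(R) = GU(σ, J)(R)` (the other half, `D(cV) = D(V)` for `c > 0`, is a statement of §3).  Named fact.
[cite: KudlaRapoport2013, Remark 4.1 (arXiv v2 p. 19)] -/
def KR2013_4_1_rem_GU_smul_eq : Prop :=
  ∀ (R : Type u) [CommRing R] (m : Type) [Fintype m] [DecidableEq m] (σ : R →+* R) (J : Matrix m m R) (c : R),
    IsUnit c → GU σ (c • J) = GU σ J

end Similitudes

/-! ## §4.4 The torus `T`, the map `ν° : G → T`, `N(ν°(g)) = ν(g)`, `ker ν° = SU(V)` -/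

section NuCirc

variable {R : Type*} [CommRing R] {m : Type*} [Fintype m] [DecidableEq m]

/-- **`ν°` for `n = 2k+1` odd** (§4.4, p. 21): `T = Res_{k/ℚ}(𝔾_{m,k})` and «`ν°(g) = det(g)/ν(g)^k` if `n = 2k+1` is
odd», REAL on pairs `(g, ν) ∈ GL_m(R) × R^×` (apply to members of `GU σ J` with `#m = 2k+1`), valued in `T(R) = R^×`.
[cite: KudlaRapoport2013, §4.4 (arXiv v2 p. 21)] -/
def nuCircOdd (k : ℕ) (p : GL m R × Rˣ) : Rˣ :=
  Matrix.GeneralLinearGroup.det p.1 * (p.2 ^ k)⁻¹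

/-- **`ν°` for `n = 2k` even** (§4.4, p. 21): `T = T¹ × 𝔾_m`, `T¹ = ker(N : Res_{k/ℚ}(𝔾_{m,k}) → 𝔾_m)`, and
«`ν°(g) = (det(g)/ν(g)^k, ν(g))` if `n = 2k` is even», REAL on pairs `(g, ν) ∈ GL_m(R) × R^×` (apply to members of
`GU σ J` with `#m = 2k`), valued in `R^× × R^×` (that the first coordinate has norm `σ(x)x = 1`, i.e. lies in `T¹(R)`, is
the named fact `KR2013_4_4_norm_nuCirc`).
[cite: KudlaRapoport2013, §4.4 (arXiv v2 p. 21)] -/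
def nuCircEven (k : ℕ) (p : GL m R × Rˣ) : Rˣ × Rˣ :=
  (Matrix.GeneralLinearGroup.det p.1 * (p.2 ^ k)⁻¹, p.2)

/-- **§4.4, «Note that, in the odd case `N(ν°(g)) = ν(g)`»** (p. 21), together with the implicit well-definedness of
`ν° : G → T¹ × 𝔾_m` in the even case (the first coordinate `det(g)/ν(g)^k` has norm `1`).  Both follow from
`N(det g) = σ(det g)·det g = ν(g)ⁿ` for a similitude of a non-degenerate form (the tree's ★
`HermitianSimilitudeDeterminant.star_det_mul_det_eq_pow`).  TYPED for `(g, ν) ∈ GU(σ, J)(R)`, `det J` a unit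
(non-degenerate `V`), `N(x) = σ(x)·x`.  Named fact.
[cite: KudlaRapoport2013, §4.4 (arXiv v2 p. 21)] -/
def KR2013_4_4_norm_nuCirc : Prop :=
  ∀ (R : Type u) [CommRing R] (m : Type) [Fintype m] [DecidableEq m] (σ : R →+* R) (J : Matrix m m R) (k : ℕ)
    (p : GL m R × Rˣ), IsUnit J.det → p ∈ GU σ J →
      (Fintype.card m = 2 * k + 1 → σ (nuCircOdd k p : R) * (nuCircOdd k p : R) = (p.2 : R)) ∧
      (Fintype.card m = 2 * k → σ ((nuCircEven k p).1 : R) * ((nuCircEven k p).1 : R) = 1)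

/-- **§4.4, «In particular, `ker(ν°) = SU(V)` in both cases»** (p. 21).  TYPED for `(g, ν) ∈ GU(σ, J)(R)` with `det J`
a unit and `n = #m ≥ 1` (the printed standing assumption; for the empty matrix the statement is false): `ν°(g, ν) = 1`
iff `g ∈ SU(σ, J)(R)` (`= U ∩ ker det`), for `n = 2k+1` with `nuCircOdd` and for `n = 2k` with `nuCircEven`.  Named fact.
[cite: KudlaRapoport2013, §4.4 (arXiv v2 p. 21)] -/
def KR2013_4_4_ker_nuCirc : Prop :=
  ∀ (R : Type u) [CommRing R] (m : Type) [Fintype m] [DecidableEq m] [Nonempty m] (σ : R →+* R)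
    (J : Matrix m m R) (k : ℕ) (p : GL m R × Rˣ), IsUnit J.det → p ∈ GU σ J →
      (Fintype.card m = 2 * k + 1 → (nuCircOdd k p = 1 ↔ p.1 ∈ SU σ J)) ∧
      (Fintype.card m = 2 * k → (nuCircEven k p = 1 ↔ p.1 ∈ SU σ J))

/-- **§4.4, the composite `ν° ∘ h`** (p. 22): «For any `h : 𝕊 → G(ℝ)`, a simple calculation shows that
`ν° ∘ h(z) = ((z/z̄)^{k−r}, z z̄)` if `n = 2k` is even, `(z/z̄)^{k−r} z` if `n = 2k+1` is odd.»  INPUT from §3 (p. 15): for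
`h ∈ D(V)`, `h(z)` acts on `V_ℝ ≅ ℂⁿ` by `z` on the positive `(n−r)`-plane and by `z̄` on the negative `r`-plane, so
`det h(z) = z^{n−r} z̄^r` and «`ν(h(z)) = |z|² = z z̄`».  TYPED as the resulting identity in `ℂ` for `z ≠ 0`, `r ≤ n`
(the first coordinate `det/ν^k`; the second coordinate in the even case is `ν(h(z)) = z z̄` itself), integer exponent
`k − r`.  Named fact.
[cite: KudlaRapoport2013, §4.4 (arXiv v2 p. 22)] -/
def KR2013_4_4_nuCirc_hodge : Prop :=
  ∀ (n r k : ℕ) (z : ℂ), z ≠ 0 → r ≤ n →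
    (n = 2 * k →
      z ^ (n - r) * (starRingEnd ℂ z) ^ r / (z * starRingEnd ℂ z) ^ k =
        (z / starRingEnd ℂ z) ^ ((k : ℤ) - (r : ℤ))) ∧
    (n = 2 * k + 1 →
      z ^ (n - r) * (starRingEnd ℂ z) ^ r / (z * starRingEnd ℂ z) ^ k =
        (z / starRingEnd ℂ z) ^ ((k : ℤ) - (r : ℤ)) * z)

end NuCirc

/-! ## §4.4 The homomorphism `ρ = N_{E/ℚ} ∘ ν° ∘ μ_h : 𝕊_ℚ → T` (the three printed formulas) -/

section Rho

variable {L : Type*} [CommRing L] (σ : L →+* L)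

/-- **`ρ` for `n = 2k` even and `r ≠ n − r`** (§4.4, p. 22; then `E = k`, `𝕊_ℚ = Res_{k/ℚ} 𝔾_m`, `T = T¹ × 𝔾_m`):
«`ρ(a) = ((a/ā)^{k−r}, a ā)`», REAL on `a ∈ L^×` for a commutative ring `L` with endomorphism `σ = ( ̄ )` (use `L = k`, `k ⊗ R₀`, or `𝔸_{k,f}` with `c ⊗ 1`),
valued in `L^× × L^×` (second coordinate `σ`-fixed).  Footnote 4 (p. 22): «In [49], eq. (1.15), the exponent `−1` in the
first factor should be eliminated.»  That `ρ = N_{E/ℚ} ∘ ν° ∘ μ_h` is the printed derivation («cf. [49], 1.c»), not typed.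
[cite: KudlaRapoport2013, §4.4 (arXiv v2 p. 22)] -/
def rhoEven (k r : ℕ) (a : Lˣ) : Lˣ × Lˣ :=
  ((a / Units.map (σ : L →* L) a) ^ ((k : ℤ) - (r : ℤ)), a * Units.map (σ : L →* L) a)

/-- **`ρ` for `n = 2k` even and `r = n − r`** (§4.4, p. 22; then `E = ℚ`, `𝕊_ℚ = 𝔾_{m,ℚ}`): «`ρ(a) = (1, a)`», REAL on
`a ∈ L^×` (apply to `a ∈ ℚ^× ⊂ L^×`), valued in `L^× × L^×`.
[cite: KudlaRapoport2013, §4.4 (arXiv v2 p. 22)] -/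
def rhoEvenMiddle (a : Lˣ) : Lˣ × Lˣ :=
  (1, a)

/-- **`ρ` for `n = 2k+1` odd** (§4.4, p. 22; then `E = k`, `T = Res_{k/ℚ} 𝔾_m`): «`ρ(a) = (a/ā)^{k−r} a`», REAL on
`a ∈ L^×`, valued in `L^×`.
[cite: KudlaRapoport2013, §4.4 (arXiv v2 p. 22)] -/
def rhoOdd (k r : ℕ) (a : Lˣ) : Lˣ :=
  (a / Units.map (σ : L →* L) a) ^ ((k : ℤ) - (r : ℤ)) * a

end Rho

/-! ## §4.4 (4.5): `π₀(Sh^V_K) ≃ T(ℚ)⁰ \ T(𝔸_f) / ν°(K)` on Mathlib's finite adèles of `k` -/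

section Components

variable (k : Type) [Field k] [NumberField k] (c : k ≃ₐ[ℚ] k)

/-- **`T(ℚ)⁰ ⊂ T(𝔸_f)` for `n` odd** (§4.4, pp. 21–22): `T = Res_{k/ℚ} 𝔾_m`, `T(𝔸_f) = 𝔸_{k,f}^×` (Mathlib: the units
of `FiniteAdeleRing (𝓞 k) k`), and `T(ℚ)⁰ = T(ℚ) ∩ T(ℝ)⁰T(𝔸_f) = k^×` (here `T(ℝ) = ℂ^×` is connected), embedded
diagonally: REAL as the range of `k^× → 𝔸_{k,f}^×`.
[cite: KudlaRapoport2013, §4.4 (arXiv v2 pp. 21–22)] -/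
noncomputable def torusRatZeroOdd : Subgroup (FiniteAdeleRing (𝓞 k) k)ˣ :=
  (Units.map (algebraMap k (FiniteAdeleRing (𝓞 k) k) : k →* FiniteAdeleRing (𝓞 k) k)).range

/-- **`T(𝔸_f)` for `n` even** (§4.4, p. 21): `T = T¹ × 𝔾_m` with `T¹ = ker(N : Res_{k/ℚ} 𝔾_{m,k} → 𝔾_m)`, so
`T(𝔸_f) = T¹(𝔸_f) × 𝔸_{ℚ,f}^×`, REAL inside `𝔸_{k,f}^× × 𝔸_{k,f}^×`: first factor the tree's
`UnitaryGroup.finAdelicOne ℚ k c = {u | (c ⊗ 1)(u)·u = 1}`, second factor the `(c ⊗ 1)`-fixed units (`= 𝔸_{ℚ,f}^×`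
inside `𝔸_{k,f} = k ⊗_ℚ 𝔸_{ℚ,f}`), `c` = the non-trivial automorphism of `k`.
[cite: KudlaRapoport2013, §4.4 (arXiv v2 p. 21)] -/
noncomputable def torusFinAdeleEven : Subgroup ((FiniteAdeleRing (𝓞 k) k)ˣ × (FiniteAdeleRing (𝓞 k) k)ˣ) :=
  (finAdelicOne ℚ k c).prod
    ((Units.map (conjFiniteAdele ℚ k c : FiniteAdeleRing (𝓞 k) k →* FiniteAdeleRing (𝓞 k) k)).eqLocus
      (MonoidHom.id _))

/-- **`T(ℚ)⁰ ⊂ T(𝔸_f)` for `n` even** (§4.4, pp. 21–22): `T(ℚ)⁰ = T(ℚ) ∩ T(ℝ)⁰T(𝔸_f)` with `T(ℝ) = S¹ × ℝ^×`,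
`T(ℝ)⁰ = S¹ × ℝ_{>0}` («`ν°(K_∞) = T(ℝ)⁰`, the identity component of `T(ℝ)`»), so `T(ℚ)⁰ = T¹(ℚ) × ℚ^×_{>0}`, REAL
inside `𝔸_{k,f}^× × 𝔸_{k,f}^×`: `T¹(ℚ) = {a ∈ k^× | c(a)·a = 1}` (the kernel of `a ↦ c(a)·a` on `k^×`) and
`ℚ^×_{>0}` (Mathlib `Units.posSubgroup ℚ`), both embedded diagonally.
[cite: KudlaRapoport2013, §4.4 (arXiv v2 pp. 21–22)] -/
noncomputable def torusRatZeroEven : Subgroup ((FiniteAdeleRing (𝓞 k) k)ˣ × (FiniteAdeleRing (𝓞 k) k)ˣ) :=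
  (((Units.map ((c : k →+* k) : k →* k) * MonoidHom.id kˣ).ker).map
      (Units.map (algebraMap k (FiniteAdeleRing (𝓞 k) k) : k →* FiniteAdeleRing (𝓞 k) k))).prod
    ((Units.posSubgroup ℚ).map
      (Units.map (((algebraMap k (FiniteAdeleRing (𝓞 k) k)).comp (algebraMap ℚ k) :
        ℚ →+* FiniteAdeleRing (𝓞 k) k) : ℚ →* FiniteAdeleRing (𝓞 k) k)))

/-- **(4.5) for `n = 2κ+1` odd.**  Printed (p. 21): «Then we have (4.5)
`π₀(Sh^V_K) ≃ T(ℚ)\T(𝔸)/ν°(K_∞ × K) = T(ℚ)⁰\T(𝔸_f)/ν°(K)`, where `T(ℚ)⁰ = T(ℚ) ∩ T(ℝ)⁰T(𝔸_f)` and `K_∞` is the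
centralizer of `h` in `G(ℝ)`.»  TYPED (the finite-adelic description) as a predicate on the level `K` — a subset of the
`𝔸_{k,f}`-points `GL_n(𝔸_{k,f}) × 𝔸_{k,f}^×` (apply to an open compact subgroup of `GU(c ⊗ 1, J)(𝔸_{k,f})`) — and a
⟨CARRIER⟩ type `pi0` for `π₀(Sh^V_K)` (no canonical model in Lean): `π₀ ≃ 𝔸_{k,f}^× ⧸ (T(ℚ)⁰ · ν°(K))` with `ν°(K)` the
subgroup generated by `nuCircOdd κ '' K` (`T` is commutative, so the double coset space is this quotient).
[cite: KudlaRapoport2013, §4.4 (4.5) (arXiv v2 p. 21)] -/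
def KR2013_4_5_pi0_odd (κ n : ℕ)
    (K : Set (GL (Fin n) (FiniteAdeleRing (𝓞 k) k) × (FiniteAdeleRing (𝓞 k) k)ˣ)) (pi0 : Type u) : Prop :=
  Nonempty (pi0 ≃ (FiniteAdeleRing (𝓞 k) k)ˣ ⧸ (torusRatZeroOdd k ⊔ Subgroup.closure (nuCircOdd κ '' K)))

/-- **(4.5) for `n = 2κ` even.**  Same printed statement (p. 21), TYPED with `T(𝔸_f) = T¹(𝔸_f) × 𝔸_{ℚ,f}^×`
(`torusFinAdeleEven`), `T(ℚ)⁰ = T¹(ℚ) × ℚ^×_{>0}` (`torusRatZeroEven`) and `ν°(K)` generated by `nuCircEven κ '' K`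
(both intersected with `T(𝔸_f)`), for a ⟨CARRIER⟩ type `pi0 = π₀(Sh^V_K)`:
`π₀ ≃ T(𝔸_f) ⧸ ((T(ℚ)⁰ · ν°(K)) ∩ T(𝔸_f))`.
[cite: KudlaRapoport2013, §4.4 (4.5) (arXiv v2 p. 21)] -/
def KR2013_4_5_pi0_even (κ n : ℕ)
    (K : Set (GL (Fin n) (FiniteAdeleRing (𝓞 k) k) × (FiniteAdeleRing (𝓞 k) k)ˣ)) (pi0 : Type u) : Prop :=
  Nonempty (pi0 ≃ torusFinAdeleEven k c ⧸
    ((torusRatZeroEven k c ⊔ Subgroup.closure (nuCircEven κ '' K)).subgroupOf (torusFinAdeleEven k c)))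

end Components

/-! ## §4.3 Proposition 4.4: the generic fibre of `𝓜(n−r,r)^{V♯}` is `Sh^V_{K♯}` (weaker-than-print shape) -/

section GenericFibre

variable (k : Type u) [Field k]

/-- **Proposition 4.4.**  Printed (p. 20): «Let `V♯ ∈ 𝓡_{(n−r,r)}(k)♯` be a relevant hermitian space. Then there is an
isomorphism of stacks over `k`, `𝓜(n−r,r)^{V♯} ×_{Spec 𝒪_k} Spec k ≃ Sh^V_{K♯}`, where `𝓜(n−r,r)^{V♯}` is the component
of `𝓜(n−r,r)` associated to the strict similarity class of `V♯` in (i) of Proposition 2.19 [v2 numbering; v1: 2.20] and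
`K♯` is the stabilizer in `G^V(𝔸_f)` of a self-dual lattice in the `G^V_1`-genus given by `V♯`.» (Proof pp. 21: the
level structure `η̄` from `j_{𝔸_f} : T(A)⁰ ⥲ V(𝔸_f)`; conversely `T(A) = η⁻¹(L ⊗ Ẑ)` and the unique `a ∈ ℚ₊^×` making `aλ`
principal.)  WEAKER-THAN-PRINT TYPING: an isomorphism of stacks over `k` induces a bijection, natural in the `k`-scheme
`S`, between the sets of isomorphism classes of `S`-points; the two presheaves of isomorphism classes on `k`-schemes
(tree ★ `Motives.SchemeOver k = Over (Spec k)`) are ⟨CARRIER⟩ parameters `MV` (for `𝓜(n−r,r)^{V♯} ×_{𝒪_k} k`) and `ShV`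
(for `Sh^V_{K♯}`), and the statement is a natural isomorphism `MV ≅ ShV`.  Remark 4.5 (p. 21): both sides depend only on
the strict similitude class of `V`; for `n` odd there is only one such class.
[cite: KudlaRapoport2013, Proposition 4.4 (arXiv v2 p. 20)] -/
def KR2013_4_4_genericFibre (MV ShV : (SchemeOver k)ᵒᵖ ⥤ Type u) : Prop :=
  Nonempty (MV ≅ ShV)

end GenericFibre

/-! ## Discharges (ED. 3, R-9a): the four CLOSED named facts above are theorems of the tree

`KR2013_4_1_rem_GU_smul_eq` (scaling `J` by a unit), `KR2013_4_4_norm_nuCirc` («`N(ν°(g)) = ν(g)`», `ν°(g) ∈ T¹` for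
`n` even), `KR2013_4_4_ker_nuCirc` («`ker(ν°) = SU(V)`») and `KR2013_4_4_nuCirc_hodge` (`ν° ∘ h(z)`) are proved as
stated.  The one input beyond unfolding is the determinant identity `σ(det g) · det g = ν(g)ⁿ` for a similitude of a
form with unit determinant, ★ `Literature.NumberTheory.Automorphic.UnitarySimilitude.sigma_det_mul_det_eq_pow`
([Kottwitz1992] §7); the rest is group arithmetic in `Rˣ` and `zpow` arithmetic in `ℂ`. -/

section Discharges

open Literature.NumberTheory.Automorphic (mem_unitaryGroupOfForm_iff)
open Literature.NumberTheory.Automorphic.UnitarySimilitude (sigma_det_mul_det_eq_pow)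

/-- **Remark 4.1, group half — proved**: `GU(σ, cJ)(R) = GU(σ, J)(R)` for a unit `c` (cancel `c` in
`c • ((gσ)ᵀ J g) = c • (ν • J)`). [cite: KudlaRapoport2013, Remark 4.1 (arXiv v2 p. 19)] -/
theorem KR2013_4_1_rem_GU_smul_eq_holds : KR2013_4_1_rem_GU_smul_eq := by
  intro R _ m _ _ σ J c hc
  ext p
  simp only [GU, Set.mem_setOf_eq, Matrix.mul_smul, Matrix.smul_mul, smul_comm (p.2 : R) c J,
    hc.smul_left_cancel]

/-- Units form of ★ `sigma_det_mul_det_eq_pow` for a member `(g, ν)` of `GU(σ, J)(R)`: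
`σ(det g) · det g = ν ^ #m` in `Rˣ` (private helper). [folklore] [cite: Kottwitz1992, §7 p. 393] -/
private theorem map_det_mul_det_of_mem_GU {R : Type*} [CommRing R] {m : Type*} [Fintype m] [DecidableEq m]
    {σ : R →+* R} {J : Matrix m m R} {p : GL m R × Rˣ} (hJ : IsUnit J.det) (hp : p ∈ GU σ J) :
    Units.map (σ : R →* R) (Matrix.GeneralLinearGroup.det p.1) * Matrix.GeneralLinearGroup.det p.1 =
      p.2 ^ Fintype.card m := by
  ext
  simp only [Units.val_mul, Units.coe_map, MonoidHom.coe_coe, Matrix.GeneralLinearGroup.val_det_apply,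
    Units.val_pow_eq_pow_val]
  exact sigma_det_mul_det_eq_pow σ hJ hp.2

/-- For `(g, ν) ∈ GU(σ, J)(R)` the multiplier is `σ`-fixed: `σ(ν) = ν` in `Rˣ` (private helper; the first defining
condition of `GU`). [folklore] -/
private theorem map_units_of_mem_GU {R : Type*} [CommRing R] {m : Type*} [Fintype m] [DecidableEq m]
    {σ : R →+* R} {J : Matrix m m R} {p : GL m R × Rˣ} (hp : p ∈ GU σ J) :
    Units.map (σ : R →* R) p.2 = p.2 :=
  Units.ext (by simpa using hp.1)

/-- **§4.4 «`N(ν°(g)) = ν(g)`» (odd `n`) and `N(ν°(g)₁) = 1` (even `n`) — proved** from `σ(det g) det g = νⁿ` and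
`σ(ν) = ν`. [cite: KudlaRapoport2013, §4.4 (arXiv v2 p. 21)] -/
theorem KR2013_4_4_norm_nuCirc_holds : KR2013_4_4_norm_nuCirc := by
  intro R _ m _ _ σ J k p hJ hp
  have key := map_det_mul_det_of_mem_GU hJ hp
  have hν := map_units_of_mem_GU hp
  set d := Matrix.GeneralLinearGroup.det p.1 with hd
  set ν := p.2 with hνdef
  constructor
  · intro hcard
    rw [hcard] at key
    have h : Units.map (σ : R →* R) (nuCircOdd k p) * nuCircOdd k p = ν := by
      simp only [nuCircOdd, map_mul, map_inv, map_pow, hν, ← hd, ← hνdef]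
      calc Units.map (σ : R →* R) d * (ν ^ k)⁻¹ * (d * (ν ^ k)⁻¹)
          = Units.map (σ : R →* R) d * d * ((ν ^ k)⁻¹ * (ν ^ k)⁻¹) := by
            simp only [mul_assoc, mul_comm, mul_left_comm]
        _ = ν := by rw [key, ← mul_inv, ← pow_add, ← two_mul, pow_succ, mul_inv_cancel_comm]
    have := congrArg Units.val h
    simpa only [Units.val_mul, Units.coe_map, MonoidHom.coe_coe] using this
  · intro hcard
    rw [hcard] at key
    have h : Units.map (σ : R →* R) (nuCircEven k p).1 * (nuCircEven k p).1 = 1 := by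
      simp only [nuCircEven, map_mul, map_inv, map_pow, hν, ← hd, ← hνdef]
      calc Units.map (σ : R →* R) d * (ν ^ k)⁻¹ * (d * (ν ^ k)⁻¹)
          = Units.map (σ : R →* R) d * d * ((ν ^ k)⁻¹ * (ν ^ k)⁻¹) := by
            simp only [mul_assoc, mul_comm, mul_left_comm]
        _ = 1 := by rw [key, ← mul_inv, ← pow_add, ← two_mul, mul_inv_cancel]
    have := congrArg Units.val h
    simpa only [Units.val_mul, Units.coe_map, MonoidHom.coe_coe, Units.val_one] using this

/-- For `(g, ν) ∈ GU(σ, J)(R)` with `det J` a unit and `m` nonempty: `g ∈ U(σ, J)(R)` iff `ν = 1`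
(`ν • J = J` forces `ν • 1 = 1` after multiplying by `J⁻¹`, then read a diagonal entry; private helper).
[folklore] [cite: KudlaRapoport2013, §4.4 (arXiv v2 p. 21)] -/
private theorem mem_unitary_iff_snd_eq_one {R : Type*} [CommRing R] {m : Type*} [Fintype m] [DecidableEq m]
    [Nonempty m] {σ : R →+* R} {J : Matrix m m R} {p : GL m R × Rˣ} (hJ : IsUnit J.det) (hp : p ∈ GU σ J) :
    p.1 ∈ unitaryGroupOfForm σ J ↔ p.2 = 1 := by
  rw [mem_unitaryGroupOfForm_iff, hp.2]
  constructor
  · intro h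
    have h1 : (p.2 : R) • (J * J⁻¹) = J * J⁻¹ := by rw [← Matrix.smul_mul, h]
    rw [Matrix.mul_nonsing_inv J hJ] at h1
    have h2 := congrFun (congrFun h1 (Classical.arbitrary m)) (Classical.arbitrary m)
    simp only [Matrix.smul_apply, Matrix.one_apply_eq, smul_eq_mul, mul_one] at h2
    exact Units.ext h2
  · intro h
    rw [h, Units.val_one, one_smul]

/-- **§4.4 «In particular, `ker(ν°) = SU(V)` in both cases» — proved** (odd `n = 2k+1`: `det g = ν^k` and
`σ(det g) det g = ν^{2k+1}` force `ν = 1`; even `n`: the second coordinate of `ν°` is `ν` itself).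
[cite: KudlaRapoport2013, §4.4 (arXiv v2 p. 21)] -/
theorem KR2013_4_4_ker_nuCirc_holds : KR2013_4_4_ker_nuCirc := by
  intro R _ m _ _ _ σ J k p hJ hp
  have key := map_det_mul_det_of_mem_GU hJ hp
  have hν := map_units_of_mem_GU hp
  have hU := mem_unitary_iff_snd_eq_one hJ hp
  simp only [SU, Subgroup.mem_inf, MonoidHom.mem_ker, hU]
  constructor
  · intro hcard
    rw [hcard] at key
    simp only [nuCircOdd, mul_inv_eq_one]
    constructor
    · intro h
      rw [h, map_pow, hν, ← pow_add, ← two_mul, pow_succ] at key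
      have hν1 : p.2 = 1 := by simpa using key
      exact ⟨hν1, by rw [h, hν1, one_pow]⟩
    · rintro ⟨hν1, hdet⟩
      rw [hdet, hν1, one_pow]
  · intro hcard
    rw [hcard] at key
    simp only [nuCircEven, Prod.mk_eq_one, mul_inv_eq_one]
    constructor
    · rintro ⟨h, hν1⟩
      exact ⟨hν1, by rw [h, hν1, one_pow]⟩
    · rintro ⟨hν1, hdet⟩
      exact ⟨by rw [hdet, hν1, one_pow], hν1⟩

/-- **§4.4 `ν° ∘ h(z)` — proved**: `z^{n−r} z̄^r / (z z̄)^k = (z/z̄)^{k−r}` (`n = 2k`), `= (z/z̄)^{k−r} z` (`n = 2k+1`), for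
`z ≠ 0`, `r ≤ n` (integer exponent `k − r`; `zpow` arithmetic). [cite: KudlaRapoport2013, §4.4 (arXiv v2 p. 22)] -/
theorem KR2013_4_4_nuCirc_hodge_holds : KR2013_4_4_nuCirc_hodge := by
  intro n r k z hz hr
  have hw : starRingEnd ℂ z ≠ 0 := (map_ne_zero _).mpr hz
  set w := starRingEnd ℂ z
  -- normalise the left-hand side to `z ^ ((n:ℤ) - r - k) * w ^ ((r:ℤ) - k)`
  have lhs : z ^ (n - r) * w ^ r / (z * w) ^ k = z ^ ((n : ℤ) - r - k) * w ^ ((r : ℤ) - k) := by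
    rw [div_eq_mul_inv, ← zpow_natCast z, ← zpow_natCast w, ← zpow_natCast (z * w), Nat.cast_sub hr,
      ← _root_.zpow_neg, mul_zpow, mul_mul_mul_comm, ← zpow_add₀ hz, ← zpow_add₀ hw]
    congr 1
  rw [lhs]
  constructor
  · intro hn
    subst hn
    rw [div_zpow, div_eq_mul_inv, ← _root_.zpow_neg]
    congr 1 <;> congr 1 <;> push_cast <;> ring
  · intro hn
    subst hn
    rw [div_zpow, div_eq_mul_inv, ← _root_.zpow_neg, mul_right_comm, ← zpow_add_one₀ hz]
    congr 1 <;> congr 1 <;> push_cast <;> ring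

end Discharges

end Literature.AlgebraicGeometry.ShimuraVarieties.KudlaRapoport2013.Sec4RelationToShimuraVarieties
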